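import Summits.CriticalPhenomena.PercolationContinuityZ3.Theorems.Transplant.Slab111HubSeg
import HarnessLib

/-!
# The HUB ROUTING of the `(111)`-films, 0: small helpers (path bodies and interiors, directed lengths, segment splitting, hub attachments)

builds on p205010 (kernel theorem, internal audit signed; external expert review pending) — NOT used in this file.  Lane `prim-bschramm`, seat
`prim-bschramm-p2` (gen 36; class C1b; memo `HOME/bschramm/P2-LATTICES.md` §130); helper file (`--supports stmt-CriticalPhenomena-4575 --as helper`).
Helpers for the hub routing lemma («Slab111HubData», «Slab111HubRoute1/2»): `GPath.eq_dropLast_concat`, `GPath.mem_interior`; the direction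
`dirOf a b = ±1` and length `lenOf a b` of the ride from level `a` to level `b` (`dir_len`); `segL_split` (a segment splits around two consecutive
vertices); the attachment predicate **`Att F d`** of a face to the hub column and **`adj_hub_att`** (the hub vertex of level `L` is adjacent to
`rideV F (L + d)`).
[cite: DuminilCopinSidoraviciusTassion2016, §2.3 (proof of Fact 2: the three disjoint paths γ_u, γ_v, γ_w in B_R(z))]
-/

noncomputable section

namespace Summit.CriticalPhenomena.PercolationContinuityZ3.Theorems.Transplant

open Literature.Probability.Percolation Literature.Probability.LatticeModels SimpleGraph
open scoped Classical

/-! ## §1 Helpers -/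

namespace GPath

variable {V : Type} {G : SimpleGraph V} {l : List V} {s t : V}

/-- A path is its body followed by its end vertex. [folklore] -/
theorem eq_dropLast_concat (h : GPath G l s t) : l = l.dropLast ++ [t] := by
  rw [← h.getLast_eq]; exact (List.dropLast_append_getLast h.ne_nil).symm

/-- An interior vertex of a path is a vertex different from both ends. [folklore] -/
theorem mem_interior (h : GPath G l s t) {x : V} (hx : x ∈ l.tail.dropLast) : x ∈ l ∧ x ≠ s ∧ x ≠ t := by
  have hl := h.eq_cons
  have hnd := h.nodup
  rw [hl] at hnd
  obtain ⟨hs, hnd'⟩ := List.nodup_cons.1 hnd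
  have hxt : x ∈ l.tail := List.mem_of_mem_dropLast hx
  refine ⟨by rw [hl]; exact List.mem_cons_of_mem _ hxt, fun hxs => hs (hxs ▸ hxt), fun hxt' => ?_⟩
  by_cases hnil : l.tail = []
  · rw [hnil] at hx; simp at hx
  · have hlast : (l.tail).getLast hnil = t := by
      have := h.last
      rw [hl, List.getLast?_cons, List.getLast?_eq_some_getLast hnil] at this
      simpa using this
    have hsplit := List.dropLast_append_getLast hnil
    rw [hlast] at hsplit
    rw [← hsplit, List.nodup_append] at hnd'
    exact hnd'.2.2 _ hx _ (List.mem_singleton_self _) hxt'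

end GPath

namespace Slab111

variable {k : ℕ}

/-- The direction from level `a` to level `b`: `+1` if `a ≤ b`, else `−1`. [folklore] -/
def dirOf (a b : ℤ) : ℤ := if a ≤ b then 1 else -1

/-- The number of steps from level `a` to level `b`. [folklore] -/
def lenOf (a b : ℤ) : ℕ := (b - a).natAbs

/-- `dirOf` is `±1`. [folklore] -/
theorem dirOf_eq (a b : ℤ) : dirOf a b = 1 ∨ dirOf a b = -1 := by unfold dirOf; split_ifs <;> simp

/-- `a + dirOf a b · lenOf a b = b`. [folklore] -/
theorem dir_len (a b : ℤ) : a + dirOf a b * (lenOf a b : ℤ) = b := by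
  unfold dirOf lenOf; split_ifs with h <;> omega

/-- **Splitting a segment around two consecutive vertices**: for `m + 1 ≤ n`, `segL a σ n = l₁ ++ rideV (a+σm) :: rideV (a+σ(m+1)) :: l₂`. [folklore] -/
theorem segL_split (z : Site 2) (c0 : ℤ) (F : FaceD) (a σ : ℤ) {m n : ℕ} (hmn : m + 1 ≤ n) :
    ∃ l₁ l₂ : List (slab111 k), segL k z c0 F a σ n = l₁ ++ rideV k z c0 F (a + σ * m) :: rideV k z c0 F (a + σ * (m + 1)) :: l₂ := by
  induction m generalizing a n with
  | zero =>
    obtain ⟨n', rfl⟩ : ∃ n', n = n' + 1 := ⟨n - 1, by omega⟩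
    rw [segL_succ]
    refine ⟨[], (segL k z c0 F (a + σ) σ n').tail, ?_⟩
    cases n' with
    | zero => simp
    | succ n'' => rw [segL_succ]; simp
  | succ m ih =>
    obtain ⟨n', rfl⟩ : ∃ n', n = n' + 1 := ⟨n - 1, by omega⟩
    obtain ⟨l₁, l₂, h⟩ := ih (a + σ) (n := n') (by omega)
    refine ⟨rideV k z c0 F a :: l₁, l₂, ?_⟩
    rw [segL_succ, h]
    simp only [List.cons_append, Nat.cast_succ]
    congr 3 <;> ring_nf

/-- **Attachment data of a face**: it attaches to the hub one level UP (`d = 1`: class-`1` column in `U`) or DOWN (`d = −1`: class-`2` column in `−U`).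
[folklore] -/
def Att (F : FaceD) (d : ℤ) : Prop := (d = 1 ∧ IsUnitU F.f1) ∨ (d = -1 ∧ IsUnitD F.f2)

/-- `Att` is decidable. [folklore] -/
instance (F : FaceD) (d : ℤ) : Decidable (Att F d) := by unfold Att; infer_instance

/-- `Att` directions are `±1`. [folklore] -/
theorem Att.dir_eq {F : FaceD} {d : ℤ} (h : Att F d) : d = 1 ∨ d = -1 := by
  rcases h with ⟨rfl, -⟩ | ⟨rfl, -⟩
  · exact Or.inl rfl
  · exact Or.inr rfl

variable {z : Site 2} {c0 : ℤ}

/-- **The hub vertex of level `L` is adjacent to the attachment vertex `rideV F (L + d)`.** [folklore] -/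
theorem adj_hub_att (hz : (3 : ℤ) ∣ z 0 + 2 * z 1 - c0) {F : FaceD} (hF : F.ok) {d : ℤ} (hA : Att F d) {L : ℤ} (hL : (3 : ℤ) ∣ L - c0)
    (h1 : 1 ≤ L) (hk : L + 1 ≤ k) : (film k).Adj (hubV k z L) (rideV k z c0 F (L + d)) := by
  rcases hA with ⟨rfl, hU⟩ | ⟨rfl, hD⟩
  · exact adj_hub_up hz hF hU hL (by omega) hk
  · have e : L + -1 = L - 1 := by ring
    rw [e]; exact (adj_hub_dn hz hF hD hL h1 (by omega)).symm

end Slab111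

end Summit.CriticalPhenomena.PercolationContinuityZ3.Theorems.Transplant

end
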